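import Literature.NumberTheory.Transcendental.KaehlerIdentityLaplacianCorollaries
import Literature.NumberTheory.Transcendental.KaehlerHodgeDolbeaultHarmonicProofs
import Literature.NumberTheory.Transcendental.KaehlerHodgeOfRealProofs
import Literature.NumberTheory.Transcendental.L2HodgeTheoryHarmonicCoexactProofs
import Literature.NumberTheory.Transcendental.FormsAlgebraWedgeAssocProofs
import Literature.NumberTheory.Transcendental.FormsAlgebraWedgeCommProofs
import Literature.Geometry.Kaehler.LefschetzPointwise
import Literature.Geometry.Kaehler.KaehlerProofs
import HarnessLib

/-!
# The Lefschetz operator preserves harmonic forms on a compact Kähler manifold (Voisin, Lemma 6.28)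

Trunk **T-KAEHLER** (`NumberTheory/Transcendental`), theorems-only file: the manifold layer between
the pointwise hard Lefschetz algebra (`Literature/LinearAlgebra/Alternating/LefschetzCAR.lean`,
`Literature/Geometry/Kaehler/LefschetzPointwise.lean`) and the hard Lefschetz theorem
`Literature.AlgebraicGeometry.Motives.hasHardLefschetzProperty_kaehlerClass` (hodge.S14; C. Voisin,
*Hodge Theory and Complex Algebraic Geometry I* (2002), §6.2.3, Thm. 6.25, whose printed proof rests
on Lemma 6.20, Thm. 5.23 and **Lemma 6.28**: "The Laplacian `Δ_d` commutes with `L`", proved there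
from `Δ_d = 2Δ_∂` (Thm. 6.7) and the Kähler identity `[∂*, L] = -i∂̄` (Prop. 6.5)). What the proof of
Thm. 6.25 uses of Lemma 6.28 is that `L = ω ∧ ·` maps harmonic forms to harmonic forms on a compact
Kähler manifold; this file proves exactly that, from the Kähler identities now in the tree:

* §InstancePath — `alternatizeUncurryFin_tangentSpace`, `wedge_tangentSpace`: the alternatization and
  the shuffle wedge computed on `T_x M` (metric instances) and on the model space `E` agree
  (cf. `wedgeOne_tangentSpace`).
* §Bridge — `lform_eq_castDeg_kaehlerForm_wedge`: **the alternatization-normalised Lefschetz operator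
  `Lform[G]` of the Kähler-identity files is `(ω ⊗ 1) ∧ ·`** for the Kähler form `ω(u, v) = g(Ju, v)`
  and the tree's shuffle wedge (reindexed `2 + k = k + 2`): pointwise both are the CAR operator
  `∑ᵢ ⟪uᵢ, ·⟫ ∧ ⟪Juᵢ, ·⟫ ∧` in a unitary frame (`alternatizeUncurryFin_lefschetz_eq_sum_wedgeOne`,
  `kaehlerTwoForm_wedge_eq_sum_wedgeOne`).
* §Harmonic — `isCHarmonicForm_lform_of_isOfType`, `isCHarmonicForm_lform_zero`,
  `isCHarmonicForm_lform`: **`L` maps `Δ_d`-harmonic complex forms to `Δ_d`-harmonic forms** on a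
  compact Kähler `(M, g)` (Hausdorff). For `γ` harmonic of pure type: `γ` is closed (Cor. 5.13), so
  `∂γ = ∂̄γ = 0`; `Δ_d = 2Δ_∂̄` (`cHodgeLaplacian_eq_two_smul_dolbeaultLaplacian_of_isManifold_complex_of_t2Space`)
  and Cor. 5.13 for `Δ_∂̄` (`isDolbeaultHarmonic_iff_of_isManifold_complex`) give `∂̄*γ = 0`; the Kähler
  identity `[∂̄*, L] = i∂` (`kaehlerP_apply_eq_zero`, `…_zero` on functions) gives `∂̄*(Lγ) = 0`, and
  `Lγ = (ω ⊗ 1) ∧ γ` is closed (Leibniz, `dω = 0`) of type `(p+1, q+1)`, so `∂̄(Lγ) = 0`: `Lγ` is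
  `Δ_∂̄`-, hence `Δ_d`-harmonic. General `γ` by the type decomposition (Cor. 6.9,
  `typeComponent_mem_charmonicForms_of_isManifold_complex_of_t2Space`) and additivity of `L`.
* §HarmonicAll (real forms) — `isHarmonicForm_kaehlerForm_wedge`: **if a real form `β` is harmonic then
  so is `ω ∧ β`** (the tree's wedge, recast to any degree `k' = 2 + k`), through `(ω ∧ β) ⊗ 1 =
  (ω ⊗ 1) ∧ (β ⊗ 1)` (`MForm.ofReal_wedge`) and `Δ_d(β ⊗ 1) = Δβ ⊗ 1`.

Conventions: the Lefschetz operator is the local notation `Lform[G, j] β` (the tree's `Lform[G] β` of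
`KaehlerLefschetzOperatorProofs.lean` with the degree `j` of `β` made explicit — the same term); metric
terms `g : ContMDiffRiemannianMetric` are installed as the Riemannian bundle by `letI` inside statements,
as in `KaehlerHodge.lean`. No definitions and no named facts are introduced (D-0026); the Hodge theorem
is NOT used here (it enters only the cohomological assembly, `Motives/`).

## References

* C. Voisin, *Hodge Theory and Complex Algebraic Geometry I*, CUP (2002), §5.1.4 Cor. 5.13, §6.1.1
  Prop. 6.5, §6.1.2 Thm. 6.7 and Cor. 6.9, §6.2.3 Thm. 6.25 and Lemma 6.28 (pp. 125–126 of the held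
  copy). [Voisin2002]
* D. Huybrechts, *Complex Geometry. An Introduction* (2005), Prop. 3.1.12, Prop. 3.3.13. [Huybrechts2005]
-/

noncomputable section

open scoped Manifold ContDiff Topology RealInnerProductSpace
open Set Function Bundle Module ContinuousAlternatingMap Complex
open Literature.LinearAlgebra.Alternating Literature.Geometry.Kaehler

namespace Literature.NumberTheory.Transcendental

set_option quotPrecheck false

set_option hygiene false in
/-- The covector family `θ_B v = ½ B(i v, ·)` of the model Lefschetz operator. -/
local notation "θE[" B' "]" => (2⁻¹ : ℝ) • ContinuousLinearMap.comp B'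
  ((Complex.I • ContinuousLinearMap.id ℂ E).restrictScalars ℝ)

set_option hygiene false in
/-- The canonical family of the model Lefschetz operator (degree `j`). -/
local notation "LfamE[" B' ", " j "]" η:max =>
  ContinuousLinearMap.comp (ContinuousAlternatingMap.alternatizeUncurryFinCLM ℝ E ℂ)
    (ContinuousLinearMap.comp (ContinuousLinearMap.flip
      (ContinuousLinearMap.smulRightL ℝ E (E [⋀^Fin j]→L[ℝ] ℂ)) η) (θE[B']))

set_option hygiene false in
/-- The model Lefschetz operator on `j`-forms. -/
local notation "LopE[" B' ", " j "]" η:max =>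
  ContinuousAlternatingMap.alternatizeUncurryFin (𝕜 := ℝ) (E := E) (F := ℂ) (LfamE[B', j] η)

set_option hygiene false in
/-- The Lefschetz operator on `j`-forms on `M` (the tree's `Lform`, with the degree explicit). -/
local notation "Lform[" G' ", " j "]" β:max =>
  @id (MForm 𝓘(ℝ, E) M ℂ (j + 1 + 1)) (fun x ↦ (LopE[G' x, j] (β x) :))

/-! ### Instance-path bookkeeping: model space versus tangent space -/

section InstancePath

variable {E : Type*} [NormedAddCommGroup E] [NormedSpace ℂ E]
  {M : Type*} [TopologicalSpace M] [ChartedSpace E M] {k l : ℕ}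
  [RiemannianBundle (fun x : M ↦ TangentSpace 𝓘(ℝ, E) x)]

/-- Alternatization computed on the tangent space `T_x M` with its metric instances and on the
model space `E` coincide (same alternating sum; cf. `wedgeOne_tangentSpace`). [folklore] -/
theorem alternatizeUncurryFin_tangentSpace (x : M)
    (Φ : E →L[ℝ] E [⋀^Fin k]→L[ℝ] ℂ) :
    alternatizeUncurryFin (E := TangentSpace 𝓘(ℝ, E) x) (F := ℂ) Φ =
      alternatizeUncurryFin (E := E) (F := ℂ) Φ :=
  ContinuousAlternatingMap.ext fun v ↦
    (alternatizeUncurryFin_apply (E := TangentSpace 𝓘(ℝ, E) x) (F := ℂ) Φ v).trans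
      (alternatizeUncurryFin_apply (E := E) (F := ℂ) Φ v).symm

/-- The shuffle wedge computed on the tangent space `T_x M` with its metric instances and on the
model space `E` coincide (same shuffle sum). [folklore] -/
theorem wedge_tangentSpace (x : M) {A : Type*} [NormedCommRing A] [NormedAlgebra ℝ A]
    (a : E [⋀^Fin k]→L[ℝ] A) (b : E [⋀^Fin l]→L[ℝ] A) :
    ContinuousAlternatingMap.wedge (V := TangentSpace 𝓘(ℝ, E) x) a b =
      ContinuousAlternatingMap.wedge (V := E) a b :=
  ContinuousAlternatingMap.ext fun v ↦
    (ContinuousAlternatingMap.wedge_apply (V := TangentSpace 𝓘(ℝ, E) x) a b v).trans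
      (ContinuousAlternatingMap.wedge_apply (V := E) a b v).symm

end InstancePath

/-! ### `L = (ω ⊗ 1) ∧ ·` -/

section Bridge

variable {E : Type*} [NormedAddCommGroup E] [NormedSpace ℂ E] [FiniteDimensional ℂ E]
  {M : Type*} [TopologicalSpace M] [ChartedSpace E M] {n : ℕ} [Fact (finrank ℝ E = n)]
  [RiemannianBundle (fun x : M ↦ TangentSpace 𝓘(ℝ, E) x)]
  (G : M → E →L[ℝ] E →L[ℝ] ℝ) (hG : ∀ (x : M) (v w : TangentSpace 𝓘(ℝ, E) x), G x v w = ⟪v, w⟫)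
  (hH : ∀ x v w, G x (Complex.I • v) (Complex.I • w) = G x v w)

include hG hH in
omit [FiniteDimensional ℂ E] [Fact (finrank ℝ E = n)] in
/-- The metric of the bundle is Hermitian when its bilinear avatar `G` is `i`-invariant. [folklore] -/
theorem isHermitian_of_avatar :
    (RiemannianBundle.g (E := fun x : M ↦ TangentSpace 𝓘(ℝ, E) x)).IsHermitian := by
  intro y v w
  change ⟪tangentJ E y v, tangentJ E y w⟫ = ⟪v, w⟫
  rw [← hG, ← hG, tangentJ_apply, tangentJ_apply]
  exact hH y v w

include hG hH in
/-- **The Lefschetz operator `L` of the Kähler-identity files is the wedge with the Kähler form.**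
For the bilinear avatar `G` of the (Hermitian) metric, the alternatization-normalised operator
`Lform[G] β` (`KaehlerLefschetzOperatorProofs.lean`) equals `(ω ⊗ 1) ∧ β` for the Kähler form
`ω(u, v) = g(Ju, v)` of the metric and the tree's shuffle wedge, reindexed along
`2 + k = k + 2` (pointwise, in a unitary frame both are `∑ᵢ ⟪uᵢ, ·⟫ ∧ ⟪Juᵢ, ·⟫ ∧ βₓ`:
`alternatizeUncurryFin_lefschetz_eq_sum_wedgeOne` and `kaehlerTwoForm_wedge_eq_sum_wedgeOne`).
Voisin (2002), §6.1.1 (`L = ω ∧ ·`). [cite: Voisin2002, §6.1.1] -/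
theorem lform_eq_castDeg_kaehlerForm_wedge {k : ℕ} (β : MForm 𝓘(ℝ, E) M ℂ k) :
    Lform[G, k] β =
      ((RiemannianBundle.g (E := fun x : M ↦ TangentSpace 𝓘(ℝ, E) x)).kaehlerForm.ofReal.wedge
        β).castDeg (Nat.add_comm 2 k) := by
  funext x
  -- the tangent space at `x` with its metric and complex structure, and a unitary frame
  set J : TangentSpace 𝓘(ℝ, E) x →L[ℝ] TangentSpace 𝓘(ℝ, E) x := tangentJ E x with hJdef
  have hJJ : ∀ v, J (J v) = -v := tangentJ_tangentJ x
  have hJ : ∀ v w, ⟪J v, J w⟫ = ⟪v, w⟫ := fun v w ↦ by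
    rw [← hG, ← hG, hJdef, tangentJ_apply, tangentJ_apply]
    exact hH x v w
  obtain ⟨d, u, hd, hu, huJ0⟩ := exists_unitaryFrame (finrank ℝ (TangentSpace 𝓘(ℝ, E) x))
    (TangentSpace 𝓘(ℝ, E) x) (J : TangentSpace 𝓘(ℝ, E) x →ₗ[ℝ] TangentSpace 𝓘(ℝ, E) x) hJJ hJ rfl
  have huJ : ∀ i j, ⟪u i, J (u j)⟫ = 0 := fun i j ↦ by simpa using huJ0 i j
  -- (1) `L` as the CAR operator
  have hΘ : ∀ a b : TangentSpace 𝓘(ℝ, E) x, (θE[G x]) a b = 2⁻¹ * ⟪J a, b⟫ := fun a b ↦ by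
    rw [← hG, hJdef, tangentJ_apply]; rfl
  have e1 := alternatizeUncurryFin_lefschetz_eq_sum_wedgeOne J hJJ hJ u hd hu huJ (θE[G x]) hΘ
    (β x) (LfamE[G x, k] (β x)) (fun a ↦
      (lfamE_apply (G x) (β x) a).trans (wedgeOne_tangentSpace x ((θE[G x]) a) (β x)).symm)
  -- (2) `ω ∧ ·` as the CAR operator
  set ωx : TangentSpace 𝓘(ℝ, E) x [⋀^Fin 2]→L[ℝ] ℂ :=
    (RiemannianBundle.g (E := fun x : M ↦ TangentSpace 𝓘(ℝ, E) x)).kaehlerForm.ofReal x with hωx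
  have hherm := isHermitian_of_avatar G hG hH
  have hω : ∀ a b, ωx ![a, b] = algebraMap ℝ ℂ ⟪J a, b⟫ := fun a b ↦ by
    rw [hωx, MForm.ofReal_apply, RiemannianMetric.kaehlerForm_apply_of_isHermitian _ hherm, hJdef,
      Complex.coe_algebraMap]
    rfl
  have e2 := kaehlerTwoForm_wedge_eq_sum_wedgeOne J hJJ hJ u hd hu huJ ωx hω (β x) (Nat.add_comm 2 k)
  -- (3) compare at a tuple `w`, through the (instance-free) evaluation formulas
  refine ContinuousAlternatingMap.ext fun w ↦ ?_
  have hL : (Lform[G, k] β) x w =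
      (∑ i, wedgeOne (innerSL ℝ (u i)) (wedgeOne (innerSL ℝ (J (u i))) (β x))) w :=
    ((alternatizeUncurryFin_apply (E := E) (F := ℂ) (LfamE[G x, k] (β x)) w).trans
      (alternatizeUncurryFin_apply (E := TangentSpace 𝓘(ℝ, E) x) (F := ℂ)
        (LfamE[G x, k] (β x)) w).symm).trans (congrFun (congrArg DFunLike.coe e1) w)
  have hR : (((RiemannianBundle.g (E := fun x : M ↦ TangentSpace 𝓘(ℝ, E) x)).kaehlerForm.ofReal.wedge
      β).castDeg (Nat.add_comm 2 k)) x w =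
      (∑ i, wedgeOne (innerSL ℝ (u i)) (wedgeOne (innerSL ℝ (J (u i))) (β x))) w :=
    ((ContinuousAlternatingMap.wedge_apply (V := E) ωx (β x)
        (fun l ↦ w (Fin.cast (Nat.add_comm 2 k) l))).trans
      (ContinuousAlternatingMap.wedge_apply (V := TangentSpace 𝓘(ℝ, E) x) ωx (β x)
        (fun l ↦ w (Fin.cast (Nat.add_comm 2 k) l))).symm).trans
      (congrFun (congrArg DFunLike.coe e2) w)
  exact hL.trans hR.symm

end Bridge

/-! ### `L` preserves `Δ_d`-harmonic forms on a compact Kähler manifold (Voisin, Lemma 6.28) -/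

section Harmonic

variable {E : Type*} [NormedAddCommGroup E] [NormedSpace ℂ E] [FiniteDimensional ℂ E]
  {M : Type*} [TopologicalSpace M] [ChartedSpace E M] {n : ℕ} [Fact (finrank ℝ E = n)]
  [IsManifold 𝓘(ℂ, E) ω M] [IsManifold 𝓘(ℝ, E) ∞ M] [T2Space M] [CompactSpace M]
  (g : ContMDiffRiemannianMetric 𝓘(ℝ, E) ∞ E (fun x : M ↦ TangentSpace 𝓘(ℝ, E) x))
  (o : (x : M) → Orientation ℝ (TangentSpace 𝓘(ℝ, E) x) (Fin n))

omit [FiniteDimensional ℂ E] [Fact (finrank ℝ E = n)] [IsManifold 𝓘(ℂ, E) ω M]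
  [IsManifold 𝓘(ℝ, E) ∞ M] [T2Space M] [CompactSpace M] in
/-- The degree cast preserves types. [folklore] -/
theorem isOfType_castDeg {k k' p q : ℕ} (h : k = k') {α : MForm 𝓘(ℝ, E) M ℂ k}
    (hα : IsOfType p q α) : IsOfType p q (α.castDeg h) := by
  subst h; exact hα

omit [FiniteDimensional ℂ E] [Fact (finrank ℝ E = n)] [IsManifold 𝓘(ℂ, E) ω M]
  [IsManifold 𝓘(ℝ, E) ∞ M] [T2Space M] [CompactSpace M] in
/-- **The Kähler form of a Hermitian metric is of type `(1, 1)`**: `ω(e^{iθ} v, e^{iθ} w) = ω(v, w)`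
for `ω(v, w) = g(Jv, w)`, `g(Jv, Jw) = g(v, w)` (with `e^{iθ} = cos θ + sin θ J`). Voisin (2002),
§3.1.1, Lemma 3.3 / (3.1) ("`ω` is a real form of type `(1,1)`"). (Local copy of
`Literature.AlgebraicGeometry.HodgeTheory.isOfType_one_one_kaehlerForm_ofReal`, whose import closure
is the whole Hodge-model layer.) [cite: Voisin2002, §3.1.1 Lemma 3.3] -/
theorem isOfType_one_one_kaehlerForm_ofReal'
    (gm : RiemannianMetric (fun x : M ↦ TangentSpace 𝓘(ℝ, E) x)) (hgm : gm.IsHermitian) :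
    IsOfType 1 1 (gm.kaehlerForm).ofReal := by
  refine ⟨rfl, fun x θ v ↦ ?_⟩
  have hexp : Complex.exp ((((1 : ℕ) : ℤ) - (1 : ℕ) : ℤ) * (θ : ℂ) * Complex.I) = 1 := by simp
  rw [hexp, one_mul, MForm.ofReal_apply, MForm.ofReal_apply]
  congr 1
  have hv : v = ![v 0, v 1] := by
    ext i; fin_cases i <;> rfl
  have hRv : (fun i ↦ tangentRotate E x θ (v i)) =
      ![tangentRotate E x θ (v 0), tangentRotate E x θ (v 1)] := by
    ext i; fin_cases i <;> rfl
  rw [hRv, RiemannianMetric.kaehlerForm_apply_of_isHermitian gm hgm]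
  conv_rhs => rw [hv, RiemannianMetric.kaehlerForm_apply_of_isHermitian gm hgm]
  have hR : ∀ a : TangentSpace 𝓘(ℝ, E) x, tangentRotate E x θ a =
      Real.cos θ • a + Real.sin θ • tangentJ E x a := fun a ↦ by
    rw [tangentRotate_eq_cos_add_sin_tangentJ]
  have hJR : tangentJ E x (tangentRotate E x θ (v 0)) =
      Real.cos θ • tangentJ E x (v 0) - Real.sin θ • v 0 := by
    rw [hR, map_add, map_smul, map_smul, tangentJ_tangentJ, smul_neg, sub_eq_add_neg]
  rw [hJR, hR (v 1)]
  simp only [map_add, map_sub, map_smul, _root_.sub_apply, _root_.smul_apply, smul_eq_mul]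
  have h1 : gm.inner x (tangentJ E x (v 0)) (tangentJ E x (v 1)) = gm.inner x (v 0) (v 1) :=
    hgm x (v 0) (v 1)
  have h2 : gm.inner x (v 0) (tangentJ E x (v 1)) = -gm.inner x (tangentJ E x (v 0)) (v 1) := by
    have h := hgm x (v 0) (tangentJ E x (v 1))
    rw [tangentJ_tangentJ, map_neg] at h
    exact h.symm
  rw [h1, h2]
  linear_combination (gm.inner x (tangentJ E x (v 0)) (v 1)) * Real.cos_sq_add_sin_sq θ

omit [T2Space M] [CompactSpace M] in
/-- `d((ω ⊗ 1) ∧ γ) = 0` for a closed smooth `γ` and the (closed, smooth) Kähler form `ω` of a smooth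
Kähler metric (Leibniz rule; Voisin (2002), §6.2.3: "as `ω` is closed, `L` commutes with `d`").
[cite: Voisin2002, §6.2.3] -/
theorem mextDeriv_castDeg_kaehlerForm_ofReal_wedge (hg : g.toRiemannianMetric.IsKaehler)
    {k k' : ℕ} (hc : 2 + k = k') {γ : MForm 𝓘(ℝ, E) M ℂ k} (hγs : IsSmoothForm γ)
    (hd : mextDeriv γ = 0) :
    mextDeriv (((g.toRiemannianMetric.kaehlerForm).ofReal.wedge γ).castDeg hc) = 0 := by
  haveI : WedgeFacts 𝓘(ℝ, E) M ℂ :=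
    wedgeFacts_of_comm (ContinuousAlternatingMap.WedgeComm_holds ℝ E ℂ)
  have hωs : IsSmoothForm (g.toRiemannianMetric.kaehlerForm).ofReal :=
    (isSmoothForm_kaehlerForm_of_isManifold_complex_holds g).ofReal
  have hωd : mextDeriv (g.toRiemannianMetric.kaehlerForm).ofReal = 0 := by
    rw [MForm.mextDeriv_ofReal_holds, hg.2, MForm.ofReal_zero]
  rw [mextDeriv_castDeg, mextDeriv_wedge hωs hγs, hωd, hd, MForm.zero_wedge, MForm.wedge_zero,
    MForm.castDeg_zero, smul_zero, add_zero, MForm.castDeg_zero]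

omit [IsManifold 𝓘(ℂ, E) ω M] in
/-- A `Δ_d`-harmonic complex form on a compact oriented Riemannian manifold without boundary
(`C^∞` metric, smooth volume form) is closed: `Re dγ = d Re γ` and Warner's Prop. 6.3 for the
harmonic real and imaginary parts (`mextDeriv_eq_zero_of_isHarmonicForm`). Voisin (2002), Cor. 5.13.
(Same statement as `Literature.AlgebraicGeometry.Motives.mextDeriv_eq_zero_of_isCHarmonicForm`, whose
module is downstream of this one.) [cite: Voisin2002, Cor. 5.13] -/
theorem cmextDeriv_eq_zero_of_isCHarmonicForm [RiemannianBundle (fun x : M ↦ TangentSpace 𝓘(ℝ, E) x)]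
    [IsContMDiffRiemannianBundle 𝓘(ℝ, E) ∞ E (fun x : M ↦ TangentSpace 𝓘(ℝ, E) x)]
    [IsContinuousRiemannianBundle E (fun x : M ↦ TangentSpace 𝓘(ℝ, E) x)]
    (ho : IsSmoothForm (riemannianVolumeForm o)) {k m : ℕ} (h : k + m = n)
    {γ : MForm 𝓘(ℝ, E) M ℂ k} (hγ : IsCHarmonicForm o h γ) : mextDeriv γ = 0 := by
  borelize E
  obtain ⟨hre, him⟩ := (isCHarmonicForm_iff_re_im o ho h γ).1 hγ
  refine MForm.ext_re_im ?_ ?_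
  · rw [MForm.re_mextDeriv_holds hγ.1, mextDeriv_eq_zero_of_isHarmonicForm o ho h hre, MForm.re_zero]
  · rw [MForm.im_mextDeriv_holds hγ.1, mextDeriv_eq_zero_of_isHarmonicForm o ho h him, MForm.im_zero]

/-- **`L` maps `Δ_d`-harmonic forms of pure type to `Δ_d`-harmonic forms** (Voisin (2002),
Lemma 6.28: `[L, Δ_d] = 0`, in the form used by the proof of Thm. 6.25), on a compact Kähler
manifold `(M, g)`, generic positive degree: if `γ` is a `Δ_d`-harmonic `(k+1)`-form of type
`(p,q)` then `L γ = (ω ⊗ 1) ∧ γ` is `Δ_d`-harmonic. Proof (through `∂̄`): `γ` is closed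
(`mextDeriv_eq_zero_of_isCHarmonicForm`), so `∂γ = ∂̄γ = 0`; `Δ_d = 2Δ_∂̄` (Voisin Thm. 6.7,
`cHodgeLaplacian_eq_two_smul_dolbeaultLaplacian_of_isManifold_complex_of_t2Space`) and Cor. 5.13
(`isDolbeaultHarmonic_iff_of_isManifold_complex`) give `∂̄*γ = 0`; the Kähler identity
`[∂̄*, L] = i∂` (Prop. 6.5, `kaehlerP_apply_eq_zero`) gives `∂̄*(Lγ) = 0`; `Lγ = (ω ⊗ 1) ∧ γ`
(`lform_eq_castDeg_kaehlerForm_wedge`) is closed (Leibniz, `dω = 0`) of type `(p+1, q+1)`, hence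
`∂̄(Lγ) = 0`; so `Lγ` is `Δ_∂̄`-, hence `Δ_d`-harmonic. [cite: Voisin2002, §6.2.3 Lemma 6.28] -/
theorem isCHarmonicForm_lform_of_isOfType (hg : g.toRiemannianMetric.IsKaehler)
    {k m₁ m₃ : ℕ} (h₁ : (k + 1 + 1 + 1) + m₁ = n) (h₃ : (k + 1) + m₃ = n) {p q : ℕ}
    {γ : MForm 𝓘(ℝ, E) M ℂ (k + 1)} (ht : IsOfType p q γ) :
    letI : RiemannianBundle (fun x : M ↦ TangentSpace 𝓘(ℝ, E) x) := ⟨g.toRiemannianMetric⟩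
    IsSmoothForm (riemannianVolumeForm o) → IsCHarmonicForm o h₃ γ →
      IsCHarmonicForm o h₁ (Lform[g.inner, k + 1] γ) := by
  intro ho hγ
  letI : RiemannianBundle (fun x : M ↦ TangentSpace 𝓘(ℝ, E) x) := ⟨g.toRiemannianMetric⟩
  haveI : IsContMDiffRiemannianBundle 𝓘(ℝ, E) ∞ E (fun x : M ↦ TangentSpace 𝓘(ℝ, E) x) :=
    ⟨g.inner, g.contMDiff, fun _ _ _ ↦ rfl⟩
  haveI : IsContinuousRiemannianBundle E (fun x : M ↦ TangentSpace 𝓘(ℝ, E) x) :=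
    ⟨g.inner, g.contMDiff.continuous, fun _ _ _ ↦ rfl⟩
  have hG : ∀ (x : M) (v w : TangentSpace 𝓘(ℝ, E) x), g.inner x v w = ⟪v, w⟫ := fun _ _ _ ↦ rfl
  have hH : ∀ (x : M) (v w : E), g.inner x (Complex.I • v) (Complex.I • w) = g.inner x v w :=
    fun x v w ↦ hg.1 x v w
  have hγs : IsSmoothForm γ := hγ.1
  -- `γ` is closed, hence `∂γ = ∂̄γ = 0`
  have hd : mextDeriv γ = 0 := cmextDeriv_eq_zero_of_isCHarmonicForm o ho h₃ hγ
  have hdbar : dolbeaultBar γ = 0 := by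
    rw [IsOfType.dolbeaultBar_eq_holds ht, hd, MForm.typeComponent_zero]
  have hdel : dolbeault γ = 0 := by
    rw [IsOfType.dolbeault_eq_holds ht, hd, MForm.typeComponent_zero]
  -- `Δ_∂̄ γ = 0`, hence `∂̄* γ = 0`
  have hKL := cHodgeLaplacian_eq_two_smul_dolbeaultLaplacian_of_isManifold_complex_of_t2Space g o
    hg h₃ hγs ho
  have hΔbar : dolbeaultLaplacian o (k + 1) m₃ h₃ γ = 0 := by
    have h0 := hγ.2
    rw [hKL] at h0
    exact (smul_eq_zero.1 h0).resolve_left two_ne_zero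
  have hadj : dolbeaultBarAdjoint o h₃ γ = 0 :=
    ((isDolbeaultHarmonic_iff_of_isManifold_complex g o hg.1 h₃ hγs ht ho).1 ⟨hγs, ht, hΔbar⟩).2
  -- `L γ`
  have hLs : IsSmoothForm (Lform[g.inner, k + 1] γ) := isSmoothForm_lform g.inner hG hγs
  have hLadj : dolbeaultBarAdjoint o h₁ (Lform[g.inner, k + 1] γ) = 0 := by
    funext x
    have key := kaehlerP_apply_eq_zero o ho g.inner hG hH hg.2 h₁ h₃ γ hγs x
    rw [hadj, hdel, lform_zero, smul_zero, sub_zero, sub_zero] at key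
    exact key
  have hLW := lform_eq_castDeg_kaehlerForm_wedge g.inner hG hH γ
  have hLd : mextDeriv (Lform[g.inner, k + 1] γ) = 0 :=
    (congrArg mextDeriv hLW).trans
      (mextDeriv_castDeg_kaehlerForm_ofReal_wedge g hg (Nat.add_comm 2 (k + 1)) hγs hd)
  have hLt' : IsOfType (p + 1) (q + 1) (((g.toRiemannianMetric.kaehlerForm).ofReal.wedge γ).castDeg
      (Nat.add_comm 2 (k + 1))) := by
    have hw := IsOfType.wedge_holds
      (isOfType_one_one_kaehlerForm_ofReal' g.toRiemannianMetric hg.1) ht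
    rw [Nat.add_comm 1 p, Nat.add_comm 1 q] at hw
    exact isOfType_castDeg _ hw
  have hLt : IsOfType (p + 1) (q + 1) (Lform[g.inner, k + 1] γ) :=
    (congrArg (IsOfType (p + 1) (q + 1)) hLW).mpr hLt'
  have hLdbar : dolbeaultBar (Lform[g.inner, k + 1] γ) = 0 := by
    rw [IsOfType.dolbeaultBar_eq_holds hLt, hLd, MForm.typeComponent_zero]
  have hLDH : IsDolbeaultHarmonic o (p + 1) (q + 1) h₁ (Lform[g.inner, k + 1] γ) :=
    (isDolbeaultHarmonic_iff_of_isManifold_complex g o hg.1 h₁ hLs hLt ho).2 ⟨hLdbar, hLadj⟩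
  have hKL' := cHodgeLaplacian_eq_two_smul_dolbeaultLaplacian_of_isManifold_complex_of_t2Space g o
    hg h₁ hLs ho
  exact ⟨hLs, by rw [hKL', hLDH.2.2, smul_zero]⟩

end Harmonic

section HarmonicAll

variable {E : Type*} [NormedAddCommGroup E] [NormedSpace ℂ E] [FiniteDimensional ℂ E]
  {M : Type*} [TopologicalSpace M] [ChartedSpace E M] {n : ℕ} [Fact (finrank ℝ E = n)]
  [IsManifold 𝓘(ℂ, E) ω M] [IsManifold 𝓘(ℝ, E) ∞ M] [T2Space M] [CompactSpace M]
  (g : ContMDiffRiemannianMetric 𝓘(ℝ, E) ∞ E (fun x : M ↦ TangentSpace 𝓘(ℝ, E) x))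
  (o : (x : M) → Orientation ℝ (TangentSpace 𝓘(ℝ, E) x) (Fin n))

/-- **`L` maps `Δ_d`-harmonic functions to `Δ_d`-harmonic `2`-forms** (degree-`0` case of
Voisin (2002), Lemma 6.28, on a compact Kähler manifold): a harmonic function `f` is closed
(`mextDeriv_eq_zero_of_isCHarmonicForm`), the Kähler identity on functions
(`kaehlerP_apply_eq_zero_zero`: `∂̄*(Lf) = i∂f = 0`) and `∂̄(Lf) = 0` (`Lf = f (ω ⊗ 1)` is closed of
type `(1,1)`) make `Lf` `Δ_∂̄`-, hence `Δ_d`-harmonic. [cite: Voisin2002, §6.2.3 Lemma 6.28] -/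
theorem isCHarmonicForm_lform_zero (hg : g.toRiemannianMetric.IsKaehler)
    {m₁ m₃ : ℕ} (h₁ : (0 + 1 + 1) + m₁ = n) (h₃ : 0 + m₃ = n) {γ : MForm 𝓘(ℝ, E) M ℂ 0} :
    letI : RiemannianBundle (fun x : M ↦ TangentSpace 𝓘(ℝ, E) x) := ⟨g.toRiemannianMetric⟩
    IsSmoothForm (riemannianVolumeForm o) → IsCHarmonicForm o h₃ γ →
      IsCHarmonicForm o h₁ (Lform[g.inner, 0] γ) := by
  intro ho hγ
  letI : RiemannianBundle (fun x : M ↦ TangentSpace 𝓘(ℝ, E) x) := ⟨g.toRiemannianMetric⟩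
  haveI : IsContMDiffRiemannianBundle 𝓘(ℝ, E) ∞ E (fun x : M ↦ TangentSpace 𝓘(ℝ, E) x) :=
    ⟨g.inner, g.contMDiff, fun _ _ _ ↦ rfl⟩
  haveI : IsContinuousRiemannianBundle E (fun x : M ↦ TangentSpace 𝓘(ℝ, E) x) :=
    ⟨g.inner, g.contMDiff.continuous, fun _ _ _ ↦ rfl⟩
  have hG : ∀ (x : M) (v w : TangentSpace 𝓘(ℝ, E) x), g.inner x v w = ⟪v, w⟫ := fun _ _ _ ↦ rfl
  have hH : ∀ (x : M) (v w : E), g.inner x (Complex.I • v) (Complex.I • w) = g.inner x v w :=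
    fun x v w ↦ hg.1 x v w
  have hγs : IsSmoothForm γ := hγ.1
  have ht : IsOfType 0 0 γ := isOfType_zero_zero γ
  have hd : mextDeriv γ = 0 := cmextDeriv_eq_zero_of_isCHarmonicForm o ho h₃ hγ
  have hdel : dolbeault γ = 0 := by
    rw [IsOfType.dolbeault_eq_holds ht, hd, MForm.typeComponent_zero]
  have hLs : IsSmoothForm (Lform[g.inner, 0] γ) := isSmoothForm_lform g.inner hG hγs
  have hLadj : dolbeaultBarAdjoint o h₁ (Lform[g.inner, 0] γ) = 0 := by
    funext x
    have key := kaehlerP_apply_eq_zero_zero o ho g.inner hG hH hg.2 h₁ γ hγs x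
    rw [hdel, smul_zero, sub_zero] at key
    exact key
  have hLW := lform_eq_castDeg_kaehlerForm_wedge g.inner hG hH γ
  have hLd : mextDeriv (Lform[g.inner, 0] γ) = 0 :=
    (congrArg mextDeriv hLW).trans
      (mextDeriv_castDeg_kaehlerForm_ofReal_wedge g hg (Nat.add_comm 2 0) hγs hd)
  have hLt' : IsOfType 1 1 (((g.toRiemannianMetric.kaehlerForm).ofReal.wedge γ).castDeg
      (Nat.add_comm 2 0)) :=
    isOfType_castDeg _ (by
      simpa using IsOfType.wedge_holds
        (isOfType_one_one_kaehlerForm_ofReal' g.toRiemannianMetric hg.1) ht)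
  have hLt : IsOfType (0 + 1) (0 + 1) (Lform[g.inner, 0] γ) :=
    (congrArg (IsOfType 1 1) hLW).mpr hLt'
  have hLdbar : dolbeaultBar (Lform[g.inner, 0] γ) = 0 := by
    rw [IsOfType.dolbeaultBar_eq_holds hLt, hLd, MForm.typeComponent_zero]
  have hLDH : IsDolbeaultHarmonic o (0 + 1) (0 + 1) h₁ (Lform[g.inner, 0] γ) :=
    (isDolbeaultHarmonic_iff_of_isManifold_complex g o hg.1 h₁ hLs hLt ho).2 ⟨hLdbar, hLadj⟩
  have hKL' := cHodgeLaplacian_eq_two_smul_dolbeaultLaplacian_of_isManifold_complex_of_t2Space g o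
    hg h₁ hLs ho
  exact ⟨hLs, by rw [hKL', hLDH.2.2, smul_zero]⟩

/-- **`L` maps `Δ_d`-harmonic forms to `Δ_d`-harmonic forms** (Voisin (2002), Lemma 6.28
`[L, Δ_d] = 0` as used in the proof of Thm. 6.25), positive degree, on a compact Kähler manifold:
decompose a `Δ_d`-harmonic `γ` into its `(p,q)`-components, which are `Δ_d`-harmonic
(Voisin Cor. 6.9, `typeComponent_mem_charmonicForms_of_isManifold_complex_of_t2Space`), and apply
`isCHarmonicForm_lform_of_isOfType` to each (`L` is additive, `lform_sum`).
[cite: Voisin2002, §6.2.3 Lemma 6.28] -/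
theorem isCHarmonicForm_lform (hg : g.toRiemannianMetric.IsKaehler)
    {k m₁ m₃ : ℕ} (h₁ : (k + 1 + 1 + 1) + m₁ = n) (h₃ : (k + 1) + m₃ = n)
    {γ : MForm 𝓘(ℝ, E) M ℂ (k + 1)} :
    letI : RiemannianBundle (fun x : M ↦ TangentSpace 𝓘(ℝ, E) x) := ⟨g.toRiemannianMetric⟩
    IsSmoothForm (riemannianVolumeForm o) → IsCHarmonicForm o h₃ γ →
      IsCHarmonicForm o h₁ (Lform[g.inner, k + 1] γ) := by
  intro ho hγ
  letI : RiemannianBundle (fun x : M ↦ TangentSpace 𝓘(ℝ, E) x) := ⟨g.toRiemannianMetric⟩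
  haveI : IsContMDiffRiemannianBundle 𝓘(ℝ, E) ∞ E (fun x : M ↦ TangentSpace 𝓘(ℝ, E) x) :=
    ⟨g.inner, g.contMDiff, fun _ _ _ ↦ rfl⟩
  haveI : IsContinuousRiemannianBundle E (fun x : M ↦ TangentSpace 𝓘(ℝ, E) x) :=
    ⟨g.inner, g.contMDiff.continuous, fun _ _ _ ↦ rfl⟩
  have hmem : γ ∈ charmonicForms o h₃ := Submodule.subset_span hγ
  -- the type components of `γ` are harmonic of pure type, so `L` of each is harmonic
  have hcomp : ∀ pq ∈ Finset.antidiagonal (k + 1),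
      IsCHarmonicForm o h₁ (Lform[g.inner, k + 1] (γ.typeComponent pq.1 pq.2)) := by
    rintro ⟨p, q⟩ hpq
    rw [Finset.mem_antidiagonal] at hpq
    have hc : γ.typeComponent p q ∈ charmonicForms o h₃ :=
      typeComponent_mem_charmonicForms_of_isManifold_complex_of_t2Space g o hg h₃ p q ho hmem
    exact isCHarmonicForm_lform_of_isOfType g o hg h₁ h₃ (isOfType_typeComponent_holds hpq γ) ho
      ((mem_charmonicForms_iff_of_contMDiffMetric o ho h₃ _).1 hc)
  -- `L γ = ∑ L γ^{p,q}`
  have hsum : Lform[g.inner, k + 1] γ =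
      ∑ pq ∈ Finset.antidiagonal (k + 1), Lform[g.inner, k + 1] (γ.typeComponent pq.1 pq.2) := by
    conv_lhs => rw [← sum_antidiagonal_typeComponent_holds γ]
    exact lform_sum g.inner _ _
  rw [hsum]
  refine (mem_charmonicForms_iff_of_contMDiffMetric o ho h₁ _).1 (Submodule.sum_mem _ ?_)
  intro pq hpq
  exact Submodule.subset_span (hcomp pq hpq)

/-! ### Real forms: `ω ∧ ·` preserves harmonic forms -/

omit [FiniteDimensional ℂ E] [Fact (finrank ℝ E = n)] [IsManifold 𝓘(ℂ, E) ω M]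
  [IsManifold 𝓘(ℝ, E) ∞ M] [T2Space M] [CompactSpace M] in
/-- Complexification commutes with the wedge product: `(α ∧ β) ⊗ 1 = (α ⊗ 1) ∧ (β ⊗ 1)`.
[folklore] -/
theorem _root_.Literature.Geometry.Kaehler.MForm.ofReal_wedge {k l : ℕ} (α : MForm 𝓘(ℝ, E) M ℝ k)
    (β : MForm 𝓘(ℝ, E) M ℝ l) : (α.wedge β).ofReal = α.ofReal.wedge β.ofReal := by
  funext x
  ext v
  rw [MForm.ofReal_apply]
  change (((α x).wedge (β x) : E [⋀^Fin (k + l)]→L[ℝ] ℝ) v : ℂ) =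
    ((Complex.ofRealCLM.compContinuousAlternatingMap (α x)).wedge
      (Complex.ofRealCLM.compContinuousAlternatingMap (β x)) : E [⋀^Fin (k + l)]→L[ℝ] ℂ) v
  rw [ContinuousAlternatingMap.wedge_apply, ContinuousAlternatingMap.wedge_apply]
  simp only [ContinuousLinearMap.compContinuousAlternatingMap_coe, Function.comp_apply,
    Complex.ofRealCLM_apply, Units.smul_def, smul_eq_mul, zsmul_eq_mul, Complex.ofReal_mul,
    Complex.ofReal_sum, Complex.ofReal_intCast, Complex.ofReal_inv, Complex.ofReal_natCast,
    Complex.real_smul]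
  rfl

omit [FiniteDimensional ℂ E] [Fact (finrank ℝ E = n)] [IsManifold 𝓘(ℂ, E) ω M]
  [IsManifold 𝓘(ℝ, E) ∞ M] [T2Space M] [CompactSpace M] in
/-- Complexification commutes with the degree cast. [folklore] -/
theorem _root_.Literature.Geometry.Kaehler.MForm.ofReal_castDeg {k k' : ℕ} (h : k = k')
    (α : MForm 𝓘(ℝ, E) M ℝ k) : (α.castDeg h).ofReal = α.ofReal.castDeg h := by
  subst h; rfl

omit [IsManifold 𝓘(ℂ, E) ω M] [IsManifold 𝓘(ℝ, E) ∞ M] [T2Space M] [CompactSpace M] in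
/-- Harmonicity is invariant under the degree cast. [folklore] -/
theorem isHarmonicForm_castDeg_iff [RiemannianBundle (fun x : M ↦ TangentSpace 𝓘(ℝ, E) x)]
    {a b m : ℕ} (e : a = b) (ha : a + m = n) (hb : b + m = n) (X : MForm 𝓘(ℝ, E) M ℝ a) :
    IsHarmonicForm o hb (X.castDeg e) ↔ IsHarmonicForm o ha X := by
  subst e; rfl

omit [IsManifold 𝓘(ℂ, E) ω M] [IsManifold 𝓘(ℝ, E) ∞ M] [T2Space M] [CompactSpace M] in
/-- A real form is harmonic iff its complexification is `Δ_d`-harmonic (`Δ_d (β ⊗ 1) = Δβ ⊗ 1`).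
[folklore] -/
theorem isHarmonicForm_iff_isCHarmonicForm_ofReal
    [RiemannianBundle (fun x : M ↦ TangentSpace 𝓘(ℝ, E) x)] {k m : ℕ} (h : k + m = n)
    (β : MForm 𝓘(ℝ, E) M ℝ k) : IsHarmonicForm o h β ↔ IsCHarmonicForm o h β.ofReal := by
  constructor
  · rintro ⟨hs, hΔ⟩
    exact ⟨hs.ofReal, by rw [cHodgeLaplacian_ofReal_holds o h β, hΔ, MForm.ofReal_zero]⟩
  · rintro ⟨hs, hΔ⟩
    refine ⟨by simpa using hs.re, ?_⟩
    have := congrArg MForm.re hΔ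
    rw [cHodgeLaplacian_ofReal_holds o h β, MForm.re_ofReal] at this
    rw [this]
    funext x; ext v; simp

/-- **The Lefschetz operator preserves harmonic forms** (Voisin (2002), Lemma 6.28 `[L, Δ_d] = 0`,
the form used in the proof of the hard Lefschetz theorem, Thm. 6.25): on a compact Kähler manifold
`(M, g)` with Kähler form `ω`, if a real `k`-form `β` is harmonic then so is `ω ∧ β` (the tree's
shuffle wedge, in any recast degree `k' = 2 + k`). From the complex statement
`isCHarmonicForm_lform` / `isCHarmonicForm_lform_zero` through `L = (ω ⊗ 1) ∧ ·`
(`lform_eq_castDeg_kaehlerForm_wedge`) and `(ω ∧ β) ⊗ 1 = (ω ⊗ 1) ∧ (β ⊗ 1)`.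
[cite: Voisin2002, §6.2.3 Lemma 6.28] -/
theorem isHarmonicForm_kaehlerForm_wedge (hg : g.toRiemannianMetric.IsKaehler)
    {k k' m m' : ℕ} (hc : 2 + k = k') (h : k + m = n) (h' : k' + m' = n) {β : MForm 𝓘(ℝ, E) M ℝ k} :
    letI : RiemannianBundle (fun x : M ↦ TangentSpace 𝓘(ℝ, E) x) := ⟨g.toRiemannianMetric⟩
    IsSmoothForm (riemannianVolumeForm o) → IsHarmonicForm o h β →
      IsHarmonicForm o h' ((g.toRiemannianMetric.kaehlerForm.wedge β).castDeg hc) := by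
  intro ho hβ
  letI : RiemannianBundle (fun x : M ↦ TangentSpace 𝓘(ℝ, E) x) := ⟨g.toRiemannianMetric⟩
  have hG : ∀ (x : M) (v w : TangentSpace 𝓘(ℝ, E) x), g.inner x v w = ⟪v, w⟫ := fun _ _ _ ↦ rfl
  have hH : ∀ (x : M) (v w : E), g.inner x (Complex.I • v) (Complex.I • w) = g.inner x v w :=
    fun x v w ↦ hg.1 x v w
  have hβc : IsCHarmonicForm o h β.ofReal := (isHarmonicForm_iff_isCHarmonicForm_ofReal o h β).1 hβ
  -- the complex statement in degree `k + 2`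
  have h₁ : (k + 1 + 1) + m' = n := by omega
  have hL : IsCHarmonicForm o h₁ (Lform[g.inner, k] β.ofReal) := by
    rcases k with - | k
    · exact isCHarmonicForm_lform_zero g o hg h₁ h ho hβc
    · exact isCHarmonicForm_lform g o hg h₁ h ho hβc
  have hL' : IsCHarmonicForm o h₁ (((g.toRiemannianMetric.kaehlerForm).ofReal.wedge β.ofReal).castDeg
      (Nat.add_comm 2 k)) :=
    (congrArg (IsCHarmonicForm o h₁) (lform_eq_castDeg_kaehlerForm_wedge g.inner hG hH β.ofReal)).mp hL
  rw [← MForm.ofReal_wedge, ← MForm.ofReal_castDeg,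
    ← isHarmonicForm_iff_isCHarmonicForm_ofReal] at hL'
  have h2 : (2 + k) + m' = n := by omega
  exact (isHarmonicForm_castDeg_iff o hc h2 h' _).2 ((isHarmonicForm_castDeg_iff o _ h2 h₁ _).1 hL')

end HarmonicAll

end Literature.NumberTheory.Transcendental
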